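import Summits.CriticalPhenomena.PercolationContinuityZ3.Theorems.TallClusterMassBound.Negative.MassExponentFamily
import Literature.Probability.Percolation.RSW

/-!
# `TallClusterMassBound` (stmt-CriticalPhenomena-0912), line `Sketch` (crux idea `accessible-skeleton-overhang`) —
# definitions: slabs and monotone-accessible points

The two objects the line `Sketch` of crux B (`Summit.CriticalPhenomena.PercolationContinuityZ3.Theses.
PercLowPointHalfSpace.TallClusterMassBound`) posits, in the vocabulary of
`Theorems/TallClusterMassBound/Negative/MassExponentFamily.lean` (`V3`, `Hs = {x | 0 ≤ x 0}`, `conn x = {0 ↔_ℍ x}`):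

* `slab h = {y | 0 ≤ y₀ ≤ h}` — the horizontal slab of height `h` above the wall (empty for `h < 0`);
* `acc x = {0 ↔ x inside slab (x 0)}` — `x` is MONOTONE-ACCESSIBLE from the wall point `0`: joined to `0` by an
  open path that never rises above the level of `x` (the "skeleton" points of the rising-water decomposition of the
  half-space cluster `C_ℍ(0)`; card `Cruxes/TallClusterMassBound/Ideas/accessible-skeleton-overhang.md`, sketch
  `Cruxes/TallClusterMassBound/SketchIdeator2.lean`, registered skeleton `Cruxes/TallClusterMassBound/Lines/Sketch.lean`).

Plus the four one-line facts every user needs: `slab h ⊆ ℍ`, `acc x ⊆ conn x`, `acc x = ∅` for `x₀ < 0`,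
measurability. Nothing here asserts anything about the crux.
-/

noncomputable section

open MeasureTheory
open Literature.Probability.Percolation Literature.Probability.LatticeModels
open Summit.CriticalPhenomena.PercolationContinuityZ3.Theorems.TallClusterMassBound.Negative

namespace Summit.CriticalPhenomena.PercolationContinuityZ3.Theorems.TallClusterMassBound.AccessibleSkeleton

/-- The slab `S_h = {y ∈ ℤ³ | 0 ≤ y₀ ≤ h}` between the wall `{y₀ = 0}` and level `h` (empty when `h < 0`).
[folklore] -/
def slab (h : ℤ) : Set V3 := {y | 0 ≤ y 0 ∧ y 0 ≤ h}

/-- `acc x`, "`x` is monotone-accessible from `0`": the wall point `0` is joined to `x` by an open path all of whose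
vertices lie in the slab `S_{x₀} = {0 ≤ y₀ ≤ x₀}` — i.e. the minimax height of `x` in the half-space cluster of `0`
equals its own height `x₀`. For `x₀ < 0` the slab is empty and `acc x = ∅` (`acc_eq_empty_of_neg`). [folklore] -/
def acc (x : V3) : Set (BondConfig V3) := openConnIn (slab (x 0)) 0 x

/-- Membership in a slab, unfolded. [folklore] -/
theorem mem_slab_iff {h : ℤ} {y : V3} : y ∈ slab h ↔ 0 ≤ y 0 ∧ y 0 ≤ h := Iff.rfl

/-- Every slab lies in the half-space `ℍ = {y | 0 ≤ y₀}`. [folklore] -/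
theorem slab_subset_Hs (h : ℤ) : slab h ⊆ Hs := fun _ hy => hy.1

/-- The wall point `0` lies in `S_h` iff `0 ≤ h`. [folklore] -/
theorem zero_mem_slab_iff {h : ℤ} : (0 : V3) ∈ slab h ↔ 0 ≤ h := by
  simp [mem_slab_iff]

/-- Accessible points belong to the half-space cluster: `acc x ⊆ conn x` (`slab (x 0) ⊆ ℍ`). [folklore] -/
theorem acc_subset_conn (x : V3) : acc x ⊆ conn x :=
  openConnIn_mono (slab_subset_Hs (x 0)) 0 x

/-- Binder-free form of `acc_subset_conn` (the registered closed sub-goal this definitions file lands under):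
every accessible point is a point of the half-space cluster. [folklore] -/
theorem acc_subset_conn_all : ∀ x : V3, acc x ⊆ conn x := acc_subset_conn

/-- Below the wall nothing is accessible: `acc x = ∅` when `x₀ < 0` (the slab `S_{x₀}` is empty). [folklore] -/
theorem acc_eq_empty_of_neg {x : V3} (hx : x 0 < 0) : acc x = ∅ := by
  ext ω
  simp only [Set.mem_empty_iff_false, iff_false]
  rintro ⟨h0, -, -⟩
  exact absurd (zero_mem_slab_iff.1 h0) (not_le.2 hx)

/-- `acc x` is measurable (a connection event on a countable vertex set). [folklore] -/
theorem measurableSet_acc (x : V3) : MeasurableSet (acc x) :=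
  measurableSet_openConnIn_of_countable _ _ _

end Summit.CriticalPhenomena.PercolationContinuityZ3.Theorems.TallClusterMassBound.AccessibleSkeleton
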